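import Summits.Ventures.HodgeRepro2.T5SU11HardyRemainder

/-!
# The strict Hardy inequality on compactly supported functions: equality forces `u ≡ 0`

Rows 479 and 482 proved, for a `C¹` function `u` on `(0, ∞)` with `u, u′` vanishing outside `[a, b] ⊂ (0, ∞)`,
the Hardy inequality `‖u‖² ≤ ‖u′‖²` in `L²((0, ∞), sinh 2t dt)` and its ground-state identity
`‖u′‖² − ‖u‖² = ∫_a^b sinh 2t (u′Ξ − uΞ′)²/Ξ²`, `Ξ = φ_1`. Here the EQUALITY CASE is settled:

* if `‖u‖² = ‖u′‖²` the remainder integral vanishes; its integrand is continuous and `≥ 0` on `[a, b]`, so it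
  vanishes on `(a, b)` (`remainder_eqOn_zero`: `integral_eq_zero_iff_of_le_of_nonneg_ae` + `eqOn_open_of_ae_eq`),
  i.e. `u′Ξ − uΞ′ = 0` there (`numerator_eq_zero`), i.e. `(u/Ξ)′ = 0` on `[a, b)` (at `a` because `u(a) = u′(a) = 0`);
* `u/Ξ` is continuous on `[a, b]`, hence constant (`constant_of_has_deriv_right_zero`) with the value `u(a)/Ξ(a) = 0`:
  **`u ≡ 0` on `ℝ`** (`eq_zero_of_hardy_eq`);
* equivalently **the Hardy inequality is STRICT for every `u ≢ 0`** (`hardy_inequality_strict`): the bottom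
  `−ρ² = −1` of the spectrum of the radial Laplacian `L = ∂² + 2 coth 2t ∂` is not attained on compactly supported
  functions, and the Rayleigh quotient of every such `u ≢ 0` exceeds `ρ² = 1` (`rayleigh_gt_one`).

Nothing is claimed about (N).

Blind lane: Mathlib + the HodgeRepro2 prefix only; no sorry; axioms ⊆ {propext, Classical.choice,
Quot.sound}.
-/

namespace Summit.Ventures.HodgeRepro2.T5SU11HardyStrict

open Filter Topology MeasureTheory intervalIntegral
open Set (Ioi Ioo Ioc Ico Icc uIcc)
open T5SU11Cartan T5SU11SphericalFunction T5SU11SphericalBounds T5SU11SphericalContinuous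
  T5SU11SphericalSolutionSpaceAll T5SU11ReductionOfOrder T5SU11RadialGreen T5SU11GroundStateTransform
  T5SU11HardyCompactSupport T5SU11HardyRemainder

section measure

variable [MeasurableSpace Circle] [BorelSpace Circle]

variable {u u' : ℝ → ℝ} (hu : ∀ t, 0 < t → HasDerivAt u (u' t) t) (hcu' : ContinuousOn u' (Ioi 0))
  {a b : ℝ} (ha : 0 < a) (hab : a ≤ b) (hua : ∀ t, t ≤ a → u t = 0) (hub : ∀ t, b ≤ t → u t = 0)
  (hu'a : ∀ t, t ≤ a → u' t = 0) (hu'b : ∀ t, b ≤ t → u' t = 0)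

include hu hcu' in
/-- The remainder integrand `sinh 2t (u′Ξ − uΞ′)²/Ξ²` is continuous on `(0, ∞)`. -/
theorem continuousOn_remainder :
    ContinuousOn (fun t => Real.sinh (2 * t) * (u' t * sph 1 (hyp t) - u t * deriv (fun t => sph 1 (hyp t)) t) ^ 2
      / sph 1 (hyp t) ^ 2) (Ioi 0) := by
  have hcu : ContinuousOn u (Ioi 0) := fun t ht => (hu t ht).continuousAt.continuousWithinAt
  have hcs : ContinuousOn (fun t => Real.sinh (2 * t)) (Ioi 0) :=
    (Real.continuous_sinh.comp (continuous_const.mul continuous_id)).continuousOn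
  have hΞ : Continuous fun t => sph 1 (hyp t) := continuous_sph_hyp 1
  have hΞ' : Continuous (deriv fun t => sph 1 (hyp t)) :=
    continuous_iff_continuousAt.mpr fun t => (hasDerivAt_deriv_sph_hyp 1 t).continuousAt
  refine (hcs.mul (((hcu'.mul hΞ.continuousOn).sub (hcu.mul hΞ'.continuousOn)).pow 2)).div
    (hΞ.continuousOn.pow 2) (fun t _ => ?_)
  exact pow_ne_zero 2 (sph_hyp_pos 1 t).ne'

include hu hcu' ha hab hua hub hu'a hu'b in
/-- **Equality in Hardy forces the remainder integrand to vanish on `(a, b)`.** -/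
theorem remainder_eqOn_zero
    (heq : ∫ t in Ioi 0, Real.sinh (2 * t) * u t ^ 2 = ∫ t in Ioi 0, Real.sinh (2 * t) * u' t ^ 2) :
    Set.EqOn (fun t => Real.sinh (2 * t) * (u' t * sph 1 (hyp t) - u t * deriv (fun t => sph 1 (hyp t)) t) ^ 2
      / sph 1 (hyp t) ^ 2) 0 (Ioo a b) := by
  have hb : 0 < b := lt_of_lt_of_le ha hab
  have hsub : uIcc a b ⊆ Ioi 0 := uIcc_subset_Ioi ha hb
  have hcont := (continuousOn_remainder hu hcu').mono hsub
  have hint : IntervalIntegrable (fun t => Real.sinh (2 * t)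
      * (u' t * sph 1 (hyp t) - u t * deriv (fun t => sph 1 (hyp t)) t) ^ 2 / sph 1 (hyp t) ^ 2) volume a b :=
    hcont.intervalIntegrable
  have h0 : ∫ t in a..b, Real.sinh (2 * t)
      * (u' t * sph 1 (hyp t) - u t * deriv (fun t => sph 1 (hyp t)) t) ^ 2 / sph 1 (hyp t) ^ 2 = 0 := by
    have h := hardy_identity_of_support hu hcu' ha hab hua hub hu'a hu'b
    rw [heq, sub_self] at h
    exact h.symm
  have hnn : 0 ≤ᵐ[volume.restrict (Ioc a b)] (fun t => Real.sinh (2 * t)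
      * (u' t * sph 1 (hyp t) - u t * deriv (fun t => sph 1 (hyp t)) t) ^ 2 / sph 1 (hyp t) ^ 2) := by
    refine ae_restrict_of_forall_mem measurableSet_Ioc (fun t ht => ?_)
    have ht0 : 0 < t := lt_of_lt_of_le ha ht.1.le
    exact div_nonneg (mul_nonneg (sinh_two_mul_pos ht0).le (sq_nonneg _)) (sq_nonneg _)
  have hae := (integral_eq_zero_iff_of_le_of_nonneg_ae hab hnn hint).mp h0
  have hae' := ae_restrict_of_ae_restrict_of_subset Set.Ioo_subset_Ioc_self hae
  refine Measure.eqOn_open_of_ae_eq hae' isOpen_Ioo (hcont.mono ?_) continuousOn_const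
  rw [Set.uIcc_of_le hab]
  exact Set.Ioo_subset_Icc_self

include hu hcu' ha hab hua hub hu'a hu'b in
/-- **Equality in Hardy forces `u′Ξ − uΞ′ = 0` on `[a, b)`.** -/
theorem numerator_eq_zero
    (heq : ∫ t in Ioi 0, Real.sinh (2 * t) * u t ^ 2 = ∫ t in Ioi 0, Real.sinh (2 * t) * u' t ^ 2)
    {t : ℝ} (ht : t ∈ Ico a b) : u' t * sph 1 (hyp t) - u t * deriv (fun t => sph 1 (hyp t)) t = 0 := by
  rcases eq_or_lt_of_le ht.1 with rfl | hlt
  · rw [hua _ le_rfl, hu'a _ le_rfl]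
    ring
  · have h := remainder_eqOn_zero hu hcu' ha hab hua hub hu'a hu'b heq ⟨hlt, ht.2⟩
    simp only [Pi.zero_apply] at h
    have hs : Real.sinh (2 * t) ≠ 0 := (sinh_two_mul_pos (lt_of_lt_of_le ha hlt.le)).ne'
    have hΞ : sph 1 (hyp t) ^ 2 ≠ 0 := pow_ne_zero 2 (sph_hyp_pos 1 t).ne'
    rcases div_eq_zero_iff.mp h with h1 | h1
    · rcases mul_eq_zero.mp h1 with h2 | h2
      · exact absurd h2 hs
      · exact pow_eq_zero_iff (by norm_num) |>.mp h2
    · exact absurd h1 hΞ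

include hu hcu' ha hab hua hub hu'a hu'b in
/-- **THE EQUALITY CASE OF THE HARDY INEQUALITY**: `‖u‖² = ‖u′‖²` in `L²(sinh 2t dt)` forces `u ≡ 0`. -/
theorem eq_zero_of_hardy_eq
    (heq : ∫ t in Ioi 0, Real.sinh (2 * t) * u t ^ 2 = ∫ t in Ioi 0, Real.sinh (2 * t) * u' t ^ 2) (t : ℝ) :
    u t = 0 := by
  have hb : 0 < b := lt_of_lt_of_le ha hab
  -- `w = u/Ξ` is continuous on `[a, b]` with right derivative `0` on `[a, b)`
  have hΞc : Continuous fun t => sph 1 (hyp t) := continuous_sph_hyp 1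
  have hwc : ContinuousOn (fun t => u t / sph 1 (hyp t)) (Icc a b) := by
    have hcu : ContinuousOn u (Ioi 0) := fun t ht => (hu t ht).continuousAt.continuousWithinAt
    refine (hcu.mono (fun x hx => lt_of_lt_of_le ha hx.1)).div hΞc.continuousOn (fun x _ => (sph_hyp_pos 1 x).ne')
  have hwd : ∀ x ∈ Ico a b, HasDerivWithinAt (fun t => u t / sph 1 (hyp t)) 0 (Set.Ici x) x := by
    intro x hx
    have hx0 : 0 < x := lt_of_lt_of_le ha hx.1
    have hd := (hu x hx0).div (hasDerivAt_sph_hyp_deriv 1 x) (sph_hyp_pos 1 x).ne'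
    rw [numerator_eq_zero hu hcu' ha hab hua hub hu'a hu'b heq hx, zero_div] at hd
    exact hd.hasDerivWithinAt
  have hconst := constant_of_has_deriv_right_zero hwc hwd
  rcases le_or_gt t a with hta | hta
  · exact hua t hta
  rcases le_or_gt b t with htb | htb
  · exact hub t htb
  have h := hconst t ⟨hta.le, htb.le⟩
  rw [hua a le_rfl, zero_div, div_eq_zero_iff] at h
  rcases h with h | h
  · exact h
  · exact absurd h (sph_hyp_pos 1 t).ne'

include hu hcu' ha hab hua hub hu'a hu'b in
/-- **THE STRICT HARDY INEQUALITY**: `‖u‖² < ‖u′‖²` in `L²(sinh 2t dt)` for every compactly supported `C¹`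
function `u ≢ 0` on `(0, ∞)`. -/
theorem hardy_inequality_strict (hne : ∃ t, u t ≠ 0) :
    ∫ t in Ioi 0, Real.sinh (2 * t) * u t ^ 2 < ∫ t in Ioi 0, Real.sinh (2 * t) * u' t ^ 2 := by
  refine lt_of_le_of_ne (hardy_inequality_of_support hu hcu' ha hab hua hub hu'a hu'b) (fun heq => ?_)
  obtain ⟨t, ht⟩ := hne
  exact ht (eq_zero_of_hardy_eq hu hcu' ha hab hua hub hu'a hu'b heq t)

omit [MeasurableSpace Circle] [BorelSpace Circle] in
include hu ha hab hua hub in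
/-- `‖u‖² > 0` in `L²(sinh 2t dt)` for a continuous compactly supported `u ≢ 0`. -/
theorem integral_sinh_mul_sq_pos (hne : ∃ t, u t ≠ 0) :
    0 < ∫ t in Ioi 0, Real.sinh (2 * t) * u t ^ 2 := by
  obtain ⟨t₀, ht₀⟩ := hne
  have ht₀a : a < t₀ := by
    by_contra h
    exact ht₀ (hua t₀ (not_lt.mp h))
  have ht₀b : t₀ < b := by
    by_contra h
    exact ht₀ (hub t₀ (not_lt.mp h))
  have hb : 0 < b := lt_of_lt_of_le ha hab
  have hcu : ContinuousOn u (Ioi 0) := fun t ht => (hu t ht).continuousAt.continuousWithinAt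
  have hcs : ContinuousOn (fun t => Real.sinh (2 * t)) (Ioi 0) :=
    (Real.continuous_sinh.comp (continuous_const.mul continuous_id)).continuousOn
  have hcont : ContinuousOn (fun t => Real.sinh (2 * t) * u t ^ 2) (Ioi 0) := hcs.mul (hcu.pow 2)
  have hnn : ∀ t, 0 < t → 0 ≤ Real.sinh (2 * t) * u t ^ 2 := fun t ht =>
    mul_nonneg (sinh_two_mul_pos ht).le (sq_nonneg _)
  have hg0 : 0 < Real.sinh (2 * t₀) * u t₀ ^ 2 :=
    mul_pos (sinh_two_mul_pos (lt_of_lt_of_le ha ht₀a.le)) (by positivity)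
  -- continuity at `t₀` gives a window on which the integrand exceeds half its value at `t₀`
  have hct : ContinuousAt (fun t => Real.sinh (2 * t) * u t ^ 2) t₀ :=
    hcont.continuousAt (Ioi_mem_nhds (lt_of_lt_of_le ha ht₀a.le))
  obtain ⟨δ, hδ, hδg⟩ : ∃ δ > 0, ∀ t, dist t t₀ < δ →
      Real.sinh (2 * t₀) * u t₀ ^ 2 / 2 < Real.sinh (2 * t) * u t ^ 2 :=
    Metric.eventually_nhds_iff.mp (hct.eventually (lt_mem_nhds (half_lt_self hg0)))
  set δ' := min δ (min (t₀ - a) (b - t₀)) with hδ'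
  have hδ'pos : 0 < δ' := lt_min hδ (lt_min (by linarith) (by linarith))
  have h1 : δ' ≤ δ := min_le_left _ _
  have h2 : δ' ≤ t₀ - a := le_trans (min_le_right _ _) (min_le_left _ _)
  have h3 : δ' ≤ b - t₀ := le_trans (min_le_right _ _) (min_le_right _ _)
  have hsub : uIcc a b ⊆ Ioi 0 := uIcc_subset_Ioi ha hb
  have hint : IntervalIntegrable (fun t => Real.sinh (2 * t) * u t ^ 2) volume a b :=
    (hcont.mono hsub).intervalIntegrable
  rw [integral_Ioi_sinh_mul_sq_eq_of_support ha hab hua hub]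
  calc (0 : ℝ) < ∫ t in (t₀ - δ')..(t₀ + δ'), Real.sinh (2 * t) * u t ^ 2 := by
        refine intervalIntegral_pos_of_pos_on (hint.mono_set ?_) (fun x hx => ?_) (by linarith)
        · rw [Set.uIcc_of_le hab, Set.uIcc_of_le (by linarith)]
          exact Set.Icc_subset_Icc (by linarith) (by linarith)
        · refine lt_trans (half_pos hg0) (hδg x ?_)
          rw [Real.dist_eq, abs_lt]
          constructor <;> linarith [hx.1, hx.2]
    _ ≤ ∫ t in a..b, Real.sinh (2 * t) * u t ^ 2 := by
        refine integral_mono_interval (by linarith) (by linarith) (by linarith) ?_ hint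
        refine ae_restrict_of_forall_mem measurableSet_Ioc (fun t ht => hnn t (lt_of_lt_of_le ha ht.1.le))

include hu hcu' ha hab hua hub hu'a hu'b in
/-- **The Rayleigh quotient exceeds `ρ² = 1`** for every compactly supported `C¹` function `u ≢ 0`. -/
theorem rayleigh_gt_one (hne : ∃ t, u t ≠ 0) :
    1 < (∫ t in Ioi 0, Real.sinh (2 * t) * u' t ^ 2) / ∫ t in Ioi 0, Real.sinh (2 * t) * u t ^ 2 := by
  rw [lt_div_iff₀ (integral_sinh_mul_sq_pos hu ha hab hua hub hne), one_mul]
  exact hardy_inequality_strict hu hcu' ha hab hua hub hu'a hu'b hne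

end measure

end Summit.Ventures.HodgeRepro2.T5SU11HardyStrict
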